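import Summits.RiemannHypothesis.RiemannHypothesis.Theorems.PfPersistenceWeilParityPair
import HarnessLib

/-!
# PF persistence — the two-parity MARGIN INHERITANCE constant (pub-rhpf, barrier-typer gen 6)

**HONEST FRAMING. This is a long-odds MECHANISM SEARCH; no RH claims.** RH-free entrywise algebra on the
cell's even → odd dictionary `oddOfEven` (`PfPersistenceWeilParityPair`, 023ff2bd28f7).

RULING A129 (a3) (adj-3 g21): margin-based density closures (F6 mirror twins, G1.MIRROR rows) match the EVEN block
to a stated entrywise margin, not exactly; transferring such a margin to the ODD block through
`oddBlock w win = oddOfEven (evenBlock w win)` needs the entrywise Lipschitz bound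
`‖oddOfEven E − oddOfEven E′‖_max ≤ N (1 + √2) ‖E − E′‖_max` — recorded there as DERIVED and offered to the
typer as a kernel line. This file is that line (PROVED): `oddOfEven` is additive (`oddOfEven_sub`), each entry
is `((j+1)/(i+1)) (E_{i+1,j+1} − √2 E_{0,j+1})` with `0 < (j+1)/(i+1) ≤ N`, hence
`abs_oddOfEven_sub_le : (∀ k l, |E k l − E′ k l| ≤ δ) → |oddOfEven E i j − oddOfEven E′ i j| ≤ N (1+√2) δ`
and the weight-table form `abs_oddBlock_sub_le` for two data's odd blocks at one window. A density row citing
the two-parity inheritance at margin `δ` may now write 'PROVED (Lipschitz ≤ N(1+√2) entrywise,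
`abs_oddBlock_sub_le`)'.
-/

set_option linter.dupNamespace false  -- the mandated namespace repeats `RiemannHypothesis`

noncomputable section

open Real Finset Matrix Set

namespace Summit.RiemannHypothesis.RiemannHypothesis.Theorems.PfPersistence

/-- PROVED: the border-deflated body is additive — `deflatedBody (E − E′) = deflatedBody E − deflatedBody E′`. [folklore] -/
theorem deflatedBody_sub {N : ℕ} (E E' : Matrix (Fin (N + 1)) (Fin (N + 1)) ℝ) :
    deflatedBody (E - E') = deflatedBody E - deflatedBody E' := by
  ext i j
  simp only [deflatedBody, Matrix.sub_apply]
  ring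

/-- PROVED: the even → odd dictionary is additive — `oddOfEven (E − E′) = oddOfEven E − oddOfEven E′`. [folklore] -/
theorem oddOfEven_sub {N : ℕ} (E E' : Matrix (Fin (N + 1)) (Fin (N + 1)) ℝ) :
    oddOfEven (E - E') = oddOfEven E - oddOfEven E' := by
  ext i j
  simp only [oddOfEven, deflatedBody_sub, Matrix.sub_apply]
  ring

/-- PROVED: the dictionary's coefficient `(j+1)/(i+1)` lies in `(0, N]` on an `N × N` odd block. [folklore] -/
theorem oddOfEven_coeff_le {N : ℕ} (i j : Fin N) :
    0 < ((((j : ℕ) + 1 : ℕ) : ℝ) / ((((i : ℕ) + 1 : ℕ) : ℝ))) ∧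
      (((j : ℕ) + 1 : ℕ) : ℝ) / ((((i : ℕ) + 1 : ℕ) : ℝ)) ≤ (N : ℝ) := by
  have hj : (((j : ℕ) + 1 : ℕ) : ℝ) ≤ (N : ℝ) := by exact_mod_cast j.isLt
  have hi : (1 : ℝ) ≤ (((i : ℕ) + 1 : ℕ) : ℝ) := by exact_mod_cast Nat.succ_le_succ (Nat.zero_le _)
  have hj0 : (0 : ℝ) < (((j : ℕ) + 1 : ℕ) : ℝ) := by exact_mod_cast Nat.succ_pos _
  refine ⟨div_pos hj0 (by linarith), ?_⟩
  rw [div_le_iff₀ (by linarith)]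
  nlinarith [Nat.cast_nonneg (α := ℝ) N]

/-- PROVED (single matrix): every entry of `oddOfEven E` is bounded by `N (1 + √2)` times the max-entry bound of
`E` — `(∀ k l, |E k l| ≤ δ) → |oddOfEven E i j| ≤ N (1+√2) δ`. [folklore] -/
theorem abs_oddOfEven_le {N : ℕ} {E : Matrix (Fin (N + 1)) (Fin (N + 1)) ℝ} {δ : ℝ}
    (h : ∀ k l, |E k l| ≤ δ) (i j : Fin N) :
    |oddOfEven E i j| ≤ (N : ℝ) * (1 + Real.sqrt 2) * δ := by
  have hδ : 0 ≤ δ := (abs_nonneg _).trans (h 0 0)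
  obtain ⟨hc0, hcN⟩ := oddOfEven_coeff_le i j
  have hs2 : 0 ≤ Real.sqrt 2 := Real.sqrt_nonneg 2
  have hbody : |deflatedBody E i j| ≤ (1 + Real.sqrt 2) * δ := by
    unfold deflatedBody
    calc |E i.succ j.succ - Real.sqrt 2 * E 0 j.succ|
        ≤ |E i.succ j.succ| + |Real.sqrt 2 * E 0 j.succ| := abs_sub _ _
      _ ≤ δ + Real.sqrt 2 * δ := by
          rw [abs_mul, abs_of_nonneg hs2]
          exact add_le_add (h _ _) (mul_le_mul_of_nonneg_left (h _ _) hs2)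
      _ = (1 + Real.sqrt 2) * δ := by ring
  simp only [oddOfEven]
  rw [abs_mul, abs_of_pos hc0]
  calc (((j : ℕ) + 1 : ℕ) : ℝ) / ((((i : ℕ) + 1 : ℕ) : ℝ)) * |deflatedBody E i j|
      ≤ (N : ℝ) * ((1 + Real.sqrt 2) * δ) :=
        mul_le_mul hcN hbody (abs_nonneg _) (Nat.cast_nonneg N)
    _ = (N : ℝ) * (1 + Real.sqrt 2) * δ := by ring

/-- **PROVED — RULING A129 (a3) AS A KERNEL LINE (margin inheritance even → odd):** an entrywise margin `δ`
between two even blocks transfers to their odd images with constant `N (1 + √2)`: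
`(∀ k l, |E k l − E′ k l| ≤ δ) → |oddOfEven E i j − oddOfEven E′ i j| ≤ N (1+√2) δ`. [folklore] -/
theorem abs_oddOfEven_sub_le {N : ℕ} {E E' : Matrix (Fin (N + 1)) (Fin (N + 1)) ℝ} {δ : ℝ}
    (h : ∀ k l, |E k l - E' k l| ≤ δ) (i j : Fin N) :
    |oddOfEven E i j - oddOfEven E' i j| ≤ (N : ℝ) * (1 + Real.sqrt 2) * δ := by
  have h' : ∀ k l, |(E - E') k l| ≤ δ := fun k l => by rw [Matrix.sub_apply]; exact h k l
  have := abs_oddOfEven_le h' i j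
  rwa [oddOfEven_sub, Matrix.sub_apply] at this

/-- **PROVED — weight-table form:** two data whose EVEN blocks agree to entrywise margin `δ` at a window have
ODD blocks (`oddDatum`) agreeing to margin `N (1 + √2) δ` at that window. For weight tables
`oddDatum (datumOf w) win = oddBlock w win` (`oddDatum_datumOf`), so this is the served odd field. [folklore] -/
theorem abs_oddDatum_sub_le {d d' : Datum} {win : Window} {δ : ℝ}
    (h : ∀ k l, |d win k l - d' win k l| ≤ δ) (i j : Fin win.N) :
    |oddDatum d win i j - oddDatum d' win i j| ≤ (win.N : ℝ) * (1 + Real.sqrt 2) * δ :=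
  abs_oddOfEven_sub_le h i j

/-- PROVED — the same for two weight tables' odd blocks: `|oddBlock w − oddBlock w′|_{ij} ≤ N (1+√2) δ` whenever
the even blocks agree to entrywise margin `δ` at the window. [folklore] -/
theorem abs_oddBlock_sub_le {w w' : Weights} {win : Window} {δ : ℝ}
    (h : ∀ k l, |evenBlock w win k l - evenBlock w' win k l| ≤ δ) (i j : Fin win.N) :
    |oddBlock w win i j - oddBlock w' win i j| ≤ (win.N : ℝ) * (1 + Real.sqrt 2) * δ := by
  rw [oddBlock_eq_oddOfEven, oddBlock_eq_oddOfEven]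
  exact abs_oddOfEven_sub_le h i j

end Summit.RiemannHypothesis.RiemannHypothesis.Theorems.PfPersistence

end
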